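import Literature.NumberTheory.GaloisRepresentations.ContinuousCupProduct
import HarnessLib

/-!
# Symmetric cup-product cochains at odd exponent are coboundaries: the orthogonality mechanism of
# Mazur–Rubin Prop. 1.3.2 (ii) as PURE group cohomology
# (cell `b2b-bsdres`, team n1011, row T-M2p-K = R1-23 located gap M2′; seat p04 GEN 6; file 1/3)

HONEST FRAMING (cell `b2b-bsdres`, run/shared/lean/b2b/bsd-rank1-residual/, verbatim in every
file): the goal of the cell is to DELETE the COMBINATION-SHAPED residual classes of the
Birch–Swinnerton-Dyer formula for ALL analytic-rank `≤ 1` elliptic curves over `ℚ` — "full BSD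
formula for every rank `≤ 1` curve in class `C`" assembled STRICTLY from published theorems — so
that the rank-`≤ 1` remainder becomes exactly the CONSTRUCTION-SHAPED classes, which are TYPED
(missing-input `Prop`s), NOT attempted. This is not "finishing BSD". Team n1011 (N10 / N11, the
additive block X4 ∧ `p = 3`): research route on the CONSTRUCTION-SHAPED class X4 (§I N11); no claim
beyond the stated classes; nothing is booked; no mark / label is changed by this file. Theorems
only (no definition, no named fact, no `sorry`); TOOL theorems of continuous group cohomology,
nothing specific to elliptic curves or to number fields.

## What and why

ROUTE-1 R1-23 (p18, "scalar transport" for the Kolyvagin-certificate sub-route (a′) of N11) needs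
the self-duality of the TRANSVERSE local condition at the Kolyvagin primes — memo M2′ = Mazur–Rubin,
*Kolyvagin systems* (Mem. AMS 799, 2004) Prop. 1.3.2 (ii) / Rubin, PCMI 18 (2011) Prop. 1.9.5 (4):
"`H¹_tr(K,T)` and `H¹_tr(K,T^*)` are orthogonal complements under `⟨ , ⟩`".  Mazur–Rubin prove the
ORTHOGONALITY through `K^×/N_{L/K}L^×` (local reciprocity for the tame extension `L/K`).  At ODD
exponent the orthogonality is pure group cohomology of the CYCLIC quotient `Gal(L/K)` acting
trivially: the cup product `H¹ × H¹ → H²` of a cyclic group of order `d` with trivial coefficients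
lands in `binom(d,2)·(−)`, which odd exponents kill.  This file is that mechanism on the tree's
homogeneous continuous cochains (`ContinuousCupProduct.lean`: `(f ∪ g)(x,y,z) = φ(f y − f x, g z − g y)`):

* `TransverseCup.cupClass_eq_zero_of_symm` — for any locally compact topological group `G` and
  continuous equivariant pairing `φ : X × Y → Z`: if the values are SYMMETRIC,
  `φ(f z − f y, g y − g x) = φ(f y − f x, g z − g y)`, and `Z` is killed by an odd integer
  `2k + 1`, then `[f ∪ g] = 0` — the invariant `1`-cochain `H(x,y) = k·φ(f y − f x, g y − g x)`
  has `dH = −2k·(f ∪ g) = f ∪ g`;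
* `cupClass_eq_zero_of_fixed_of_symm`, `cupClass_eq_zero_of_fixed_of_cyclic` — symmetry holds
  when `f`, `g` have `G`-FIXED values and vanish on the kernel of a character `χ : G →* Q` whose
  image is generated by one value `χ σ` (`f(σ^i h) = i·f σ`, so `φ(f s, g t) = ij·φ(f σ, g σ)`);
* `cupClass_eq_zero_of_principal_of_cyclic`, `cupProduct_eq_zero_of_principal_of_cyclic` — the
  same for cocycles / classes merely PRINCIPAL on `ker χ` (inflation–restriction by hand: subtract
  the principal part; the values then lie in `X^{ker χ}`, which is `G`-fixed under the hypothesis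
  "`X^{ker χ} = X^G`", e.g. an unramified module and a character onto on inertia).

The sequel `TransverseLocalPairingVanishing.lean` instantiates this at a finite place `v` of a
number field (`G = Γ_{K_v}`, `χ = χ̄_ℓ`, `L = K_v(μ_ℓ)`, the evaluation pairing `M × M^D → μₙ`):
transverse classes cup to ZERO for odd `n`, for EVERY family of local invariant maps; and
`TransverseOrthogonal.lean` proves n1011-lit's predicate `LocalInvariants.TransverseOrthogonal` for
every perfect family at odd `n`.  ("Odd" is sharp: at `n = 2`, `K = ℚ₃`, `T = ℤ/2`, `L = ℚ₃(μ₃)`,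
`(−3, −3)₃ = −1`; the printed proposition tacitly needs `p` odd.)

References: B. Mazur, K. Rubin, *Kolyvagin systems*, Mem. AMS 168 (2004) no. 799, Prop. 1.3.2 (ii)
(p. 12) [MazurRubin2004]; K. Rubin, *Euler systems and Kolyvagin systems*, PCMI 18 (2011),
Prop. 1.9.5 (4) (p. 14) [Rubin2011]; J. Neukirch, A. Schmidt, K. Wingberg, *Cohomology of Number
Fields* (2008), I §4 (cup product on homogeneous cochains) [NeukirchSchmidtWingberg2008].
-/

noncomputable section

open CategoryTheory Function
open scoped ContRepresentation

universe u v

namespace Summit.BirchSwinnertonDyer.Rank1Residual.GaloisImage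

namespace TransverseCup

open Literature.NumberTheory.GaloisRepresentations
open _root_.TopRep _root_.ContRepresentation _root_.ContinuousCohomology

/-! ## §A. Abstract: symmetric cup-product cochains at odd exponent are coboundaries -/

section Abstract

variable {R : Type u} [CommRing R] [TopologicalSpace R]
variable {G : Type v} [Group G] [TopologicalSpace G] [IsTopologicalGroup G] [LocallyCompactSpace G]
variable {X Y Z : TopRep.{v} R G} (φ : ContPairing X Y Z)

/-- **A symmetric cup-product cochain with values killed by an odd integer is a coboundary.**  For
continuous crossed homomorphisms `f : G → X`, `g : G → Y` and a continuous equivariant pairing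
`φ : X × Y → Z`: if `φ(f z − f y, g y − g x) = φ(f y − f x, g z − g y)` for all `x y z` and
`(2k+1)·Z = 0`, then `[f ∪ g] = 0` in `H²_cont(G, Z)` — `f ∪ g = dH` for the invariant homogeneous
`1`-cochain `H(x, y) = k·φ(f y − f x, g y − g x)` (`dH = −2k·(f ∪ g) = (f ∪ g) − (2k+1)·(f ∪ g)`).
[folklore] -/
theorem cupClass_eq_zero_of_symm (f : contOneCocycles X) (g : contOneCocycles Y)
    (hS : ∀ x y z : G,
      φ.toLin (f.1 z - f.1 y) (g.1 y - g.1 x) = φ.toLin (f.1 y - f.1 x) (g.1 z - g.1 y))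
    (k : ℕ) (hZ : ∀ z : Z, (2 * k + 1) • z = 0) :
    φ.cupClass f g = 0 := by
  unfold ContPairing.cupClass
  rw [cxClass_eq_zero_iff _ 2 3 up_nat_next_two 1 up_nat_prev_two]
  let H : C(G × G, Z) :=
    ⟨fun p => k • φ.toLin (f.1 p.2 - f.1 p.1) (g.1 p.2 - g.1 p.1),
      (φ.continuous_toLin.comp (((f.1.continuous.comp continuous_snd).sub
        (f.1.continuous.comp continuous_fst)).prodMk
        ((g.1.continuous.comp continuous_snd).sub (g.1.continuous.comp continuous_fst)))).const_smul k⟩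
  have hH : ∀ x y, H (x, y) = k • φ.toLin (f.1 y - f.1 x) (g.1 y - g.1 x) := fun _ _ => rfl
  have hHinv : ∀ (s x y : G), Z.ρ s (H (s⁻¹ * x, s⁻¹ * y)) = H (x, y) := by
    intro s x y
    rw [hH, hH, map_nsmul, ← φ.toLin_smul, map_sub (X.ρ s), map_sub (Y.ρ s),
      contOneCocycles.apply_smul_inv_mul, contOneCocycles.apply_smul_inv_mul,
      contOneCocycles.apply_smul_inv_mul, contOneCocycles.apply_smul_inv_mul,
      sub_sub_sub_cancel_right, sub_sub_sub_cancel_right]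
  refine ⟨ContPairing.oneCochainOfFun H hHinv, Subtype.ext ?_⟩
  refine ContinuousMap.ext fun x => ContinuousMap.ext fun y => ContinuousMap.ext fun z => ?_
  rw [ContPairing.d_one_two_apply, ContPairing.oneCochainOfFun_apply, ContPairing.oneCochainOfFun_apply,
    ContPairing.oneCochainOfFun_apply,
    ContPairing.cupTwoCochain_apply, hH, hH, hH]
  have hfz : f.1 z - f.1 x = (f.1 y - f.1 x) + (f.1 z - f.1 y) := by abel
  have hgz : g.1 z - g.1 x = (g.1 y - g.1 x) + (g.1 z - g.1 y) := by abel
  rw [hfz, hgz]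
  simp only [map_add, LinearMap.add_apply]
  rw [hS x y z]
  set t := φ.toLin (f.1 y - f.1 x) (g.1 z - g.1 y)
  set a := φ.toLin (f.1 z - f.1 y) (g.1 z - g.1 y)
  set b := φ.toLin (f.1 y - f.1 x) (g.1 y - g.1 x)
  have ht : t = -(2 • k • t) := by
    have h := hZ t
    rw [add_smul, one_smul, mul_smul] at h
    exact eq_neg_of_add_eq_zero_right h
  rw [smul_add, smul_add, smul_add]
  calc _ = -(2 • k • t) := by abel
    _ = t := ht.symm


/-! ### Crossed homomorphisms with fixed values -/

omit [IsTopologicalGroup G] [LocallyCompactSpace G] in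
/-- A crossed homomorphism with `G`-fixed values is a homomorphism: `f(y⁻¹ z) = f z − f y`. [folklore] -/
theorem apply_inv_mul_of_fixed (f : contOneCocycles X) (hf : ∀ s t : G, X.ρ t (f.1 s) = f.1 s)
    (y z : G) : f.1 (y⁻¹ * z) = f.1 z - f.1 y := by
  rw [← hf (y⁻¹ * z) y, contOneCocycles.apply_smul_inv_mul]

omit [IsTopologicalGroup G] [LocallyCompactSpace G] in
/-- A crossed homomorphism with `G`-fixed values is a homomorphism: `f(s t) = f s + f t`. [folklore] -/
theorem apply_mul_of_fixed (f : contOneCocycles X) (hf : ∀ s t : G, X.ρ t (f.1 s) = f.1 s)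
    (s t : G) : f.1 (s * t) = f.1 s + f.1 t := by
  rw [f.2 s t, hf]

/-- **`[f ∪ g] = 0` for crossed homomorphisms with `G`-FIXED values whose values pair SYMMETRICALLY**
(`φ(f s, g t) = φ(f t, g s)`), when `Z` is killed by an odd integer: then
`φ(f z − f y, g y − g x) = φ(f(y⁻¹z), g(x⁻¹y)) = φ(f(x⁻¹y), g(y⁻¹z))` and `cupClass_eq_zero_of_symm`
applies. [folklore] -/
theorem cupClass_eq_zero_of_fixed_of_symm (f : contOneCocycles X) (g : contOneCocycles Y)
    (hf : ∀ s t : G, X.ρ t (f.1 s) = f.1 s) (hg : ∀ s t : G, Y.ρ t (g.1 s) = g.1 s)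
    (hS : ∀ s t : G, φ.toLin (f.1 s) (g.1 t) = φ.toLin (f.1 t) (g.1 s))
    (k : ℕ) (hZ : ∀ z : Z, (2 * k + 1) • z = 0) :
    φ.cupClass f g = 0 := by
  refine cupClass_eq_zero_of_symm φ f g (fun x y z => ?_) k hZ
  rw [← apply_inv_mul_of_fixed f hf y z, ← apply_inv_mul_of_fixed f hf x y,
    ← apply_inv_mul_of_fixed g hg x y, ← apply_inv_mul_of_fixed g hg y z, hS]

/-! ### Through a character with cyclic image -/

omit [IsTopologicalGroup G] [LocallyCompactSpace G] in
/-- `f(σ^m) = m·f(σ)` for a crossed homomorphism with `G`-fixed values. [folklore] -/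
theorem apply_pow_of_fixed (f : contOneCocycles X) (hf : ∀ s t : G, X.ρ t (f.1 s) = f.1 s)
    (σ : G) (m : ℕ) : f.1 (σ ^ m) = m • f.1 σ := by
  induction m with
  | zero => rw [pow_zero, contOneCocycles.apply_one, zero_smul]
  | succ m ih => rw [pow_succ, apply_mul_of_fixed f hf, ih, succ_nsmul]

omit [IsTopologicalGroup G] [LocallyCompactSpace G] in
/-- A crossed homomorphism with `G`-fixed values vanishing on `ker χ` is determined by `f σ` on the
fibre `χ s = χ σ ^ i`: `f s = i·f σ` (`s = σ^i·h`, `h ∈ ker χ`). [folklore] -/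
theorem apply_eq_smul_of_fixed_of_ker {Q : Type*} [Group Q] (χ : G →* Q) (f : contOneCocycles X)
    (hf : ∀ s t : G, X.ρ t (f.1 s) = f.1 s) (hfH : ∀ h : G, χ h = 1 → f.1 h = 0)
    {σ s : G} {i : ℕ} (hi : χ s = χ σ ^ i) : f.1 s = i • f.1 σ := by
  have hh : χ ((σ ^ i)⁻¹ * s) = 1 := by rw [map_mul, map_inv, map_pow, hi, inv_mul_cancel]
  calc f.1 s = f.1 (σ ^ i * ((σ ^ i)⁻¹ * s)) := by rw [mul_inv_cancel_left]
    _ = f.1 (σ ^ i) + f.1 ((σ ^ i)⁻¹ * s) := apply_mul_of_fixed f hf _ _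
    _ = i • f.1 σ := by rw [hfH _ hh, add_zero, apply_pow_of_fixed f hf]

/-- **`[f ∪ g] = 0` for crossed homomorphisms with `G`-fixed values, vanishing on the kernel of a
character `χ : G →* Q` whose image is generated by one value `χ σ`**, when `Z` is killed by an odd
integer: `φ(f s, g t) = (ij)·φ(f σ, g σ)` for `χ s = χ σ^i`, `χ t = χ σ^j` is symmetric
(`cupClass_eq_zero_of_fixed_of_symm`).  This is the cohomology of the CYCLIC quotient `G/ker χ` with
trivial action: `H¹ ∪ H¹ → H²` lands in `binom(d,2)·(−)`, killed by odd exponents. [folklore] -/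
theorem cupClass_eq_zero_of_fixed_of_cyclic {Q : Type*} [Group Q] (χ : G →* Q)
    (f : contOneCocycles X) (g : contOneCocycles Y)
    (hf : ∀ s t : G, X.ρ t (f.1 s) = f.1 s) (hg : ∀ s t : G, Y.ρ t (g.1 s) = g.1 s)
    (hfH : ∀ h : G, χ h = 1 → f.1 h = 0) (hgH : ∀ h : G, χ h = 1 → g.1 h = 0)
    (hcyc : ∃ σ : G, ∀ s : G, ∃ i : ℕ, χ s = χ σ ^ i)
    (k : ℕ) (hZ : ∀ z : Z, (2 * k + 1) • z = 0) :
    φ.cupClass f g = 0 := by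
  obtain ⟨σ, hσ⟩ := hcyc
  refine cupClass_eq_zero_of_fixed_of_symm φ f g hf hg (fun s t => ?_) k hZ
  obtain ⟨i, hi⟩ := hσ s
  obtain ⟨j, hj⟩ := hσ t
  rw [apply_eq_smul_of_fixed_of_ker χ f hf hfH hi, apply_eq_smul_of_fixed_of_ker χ g hg hgH hj,
    apply_eq_smul_of_fixed_of_ker χ f hf hfH hj, apply_eq_smul_of_fixed_of_ker χ g hg hgH hi]
  simp only [map_nsmul, LinearMap.smul_apply]
  exact smul_comm _ _ _

/-! ### Cocycles principal on the kernel of the character (inflation–restriction by hand) -/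

omit [IsTopologicalGroup G] [LocallyCompactSpace G] in
/-- The values of a crossed homomorphism vanishing on `ker χ` lie in `X^{ker χ}` (`f(hs) = h·f(s)` and
`hs = s·(s⁻¹hs)` with `s⁻¹hs ∈ ker χ`), hence are `G`-fixed when `X^{ker χ} = X^G` (hypothesis `hXI`:
e.g. an unramified module and a character onto on inertia, p18's `apply_eq_self_of_forall_ker`).
[folklore] -/
theorem fixed_of_vanishing_of_ker {Q : Type*} [Group Q] (χ : G →* Q) (f : contOneCocycles X)
    (hXI : ∀ (s : G) (x : X), (∀ h : G, χ h = 1 → X.ρ h x = x) → X.ρ s x = x)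
    (hfH : ∀ h : G, χ h = 1 → f.1 h = 0) (s t : G) : X.ρ t (f.1 s) = f.1 s := by
  refine hXI t (f.1 s) fun h hh => ?_
  have hconj : χ (s⁻¹ * h * s) = 1 := by
    rw [map_mul, map_mul, map_inv, hh, mul_one, inv_mul_cancel]
  have h1 : f.1 (h * s) = X.ρ h (f.1 s) := by rw [f.2 h s, hfH h hh, zero_add]
  have h2 : f.1 (h * s) = f.1 s := by
    rw [show h * s = s * (s⁻¹ * h * s) by rw [mul_assoc s⁻¹ h s, mul_inv_cancel_left], f.2 s,
      hfH _ hconj, map_zero, add_zero]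
  rw [← h1, h2]

/-- **`[f ∪ g] = 0` for crossed homomorphisms PRINCIPAL on `ker χ`** (`f h = h x − x`, `g h = h y − y`
on `ker χ`), for a character `χ : G →* Q` whose image is generated by one value, modules with
`X^{ker χ} = X^G`, `Y^{ker χ} = Y^G` and continuous orbit maps, and `Z` killed by an odd integer:
inflation–restriction by hand — subtract the principal cocycles of `x`, `y` (same classes,
`cupClass_congr_left/right`), the differences vanish on `ker χ` and have `G`-fixed values
(`fixed_of_vanishing_of_ker`), and `cupClass_eq_zero_of_fixed_of_cyclic` applies.  The orthogonality
mechanism of Mazur–Rubin Prop. 1.3.2 (ii) at odd exponent, without class field theory.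
[cite: MazurRubin2004, Prop. 1.3.2 (ii) (p. 12)] -/
theorem cupClass_eq_zero_of_principal_of_cyclic {Q : Type*} [Group Q] (χ : G →* Q)
    (f : contOneCocycles X) (g : contOneCocycles Y)
    (hXc : ∀ x : X, Continuous fun s : G => X.ρ s x) (hYc : ∀ y : Y, Continuous fun s : G => Y.ρ s y)
    (hXI : ∀ (s : G) (x : X), (∀ h : G, χ h = 1 → X.ρ h x = x) → X.ρ s x = x)
    (hYI : ∀ (s : G) (y : Y), (∀ h : G, χ h = 1 → Y.ρ h y = y) → Y.ρ s y = y)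
    (hfH : ∃ x : X, ∀ h : G, χ h = 1 → f.1 h = X.ρ h x - x)
    (hgH : ∃ y : Y, ∀ h : G, χ h = 1 → g.1 h = Y.ρ h y - y)
    (hcyc : ∃ σ : G, ∀ s : G, ∃ i : ℕ, χ s = χ σ ^ i)
    (k : ℕ) (hZ : ∀ z : Z, (2 * k + 1) • z = 0) :
    φ.cupClass f g = 0 := by
  obtain ⟨x, hx⟩ := hfH
  obtain ⟨y, hy⟩ := hgH
  -- the principal cocycles of `x` and `y`
  let px : contOneCocycles X := ⟨⟨fun s => X.ρ s x - x, (hXc x).sub continuous_const⟩, fun s t => by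
    change X.ρ (s * t) x - x = (X.ρ s x - x) + X.ρ s (X.ρ t x - x)
    rw [map_mul, map_sub]
    change X.ρ s (X.ρ t x) - x = (X.ρ s x - x) + (X.ρ s (X.ρ t x) - X.ρ s x)
    abel⟩
  let py : contOneCocycles Y := ⟨⟨fun s => Y.ρ s y - y, (hYc y).sub continuous_const⟩, fun s t => by
    change Y.ρ (s * t) y - y = (Y.ρ s y - y) + Y.ρ s (Y.ρ t y - y)
    rw [map_mul, map_sub]
    change Y.ρ s (Y.ρ t y) - y = (Y.ρ s y - y) + (Y.ρ s (Y.ρ t y) - Y.ρ s y)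
    abel⟩
  have hpx : oneCocycleClass X px = 0 := (oneCocycleClass_eq_zero_iff X px).2 ⟨x, fun _ => rfl⟩
  have hpy : oneCocycleClass Y py = 0 := (oneCocycleClass_eq_zero_iff Y py).2 ⟨y, fun _ => rfl⟩
  have hf' : oneCocycleClass X f = oneCocycleClass X (f - px) := by
    rw [oneCocycleClass_sub, hpx, sub_zero]
  have hg' : oneCocycleClass Y g = oneCocycleClass Y (g - py) := by
    rw [oneCocycleClass_sub, hpy, sub_zero]
  rw [φ.cupClass_congr_left g hf', φ.cupClass_congr_right (f - px) hg']
  have hfH' : ∀ h : G, χ h = 1 → (f - px).1 h = 0 := fun h hh => by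
    change f.1 h - (X.ρ h x - x) = 0
    rw [hx h hh, sub_self]
  have hgH' : ∀ h : G, χ h = 1 → (g - py).1 h = 0 := fun h hh => by
    change g.1 h - (Y.ρ h y - y) = 0
    rw [hy h hh, sub_self]
  exact cupClass_eq_zero_of_fixed_of_cyclic φ χ (f - px) (g - py)
    (fixed_of_vanishing_of_ker χ (f - px) hXI hfH') (fixed_of_vanishing_of_ker χ (g - py) hYI hgH')
    hfH' hgH' hcyc k hZ

/-- **`a ∪ b = 0` for classes `a ∈ H¹(G, X)`, `b ∈ H¹(G, Y)` whose restrictions to `ker χ` vanish**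
(every representative is principal on `ker χ`), under the hypotheses of
`cupClass_eq_zero_of_principal_of_cyclic` (`oneCocycleClass_surjective`,
`cupProduct_oneCocycleClass`). [cite: MazurRubin2004, Prop. 1.3.2 (ii) (p. 12)] -/
theorem cupProduct_eq_zero_of_principal_of_cyclic {Q : Type*} [Group Q] (χ : G →* Q)
    (a : continuousCohomology 1 X) (b : continuousCohomology 1 Y)
    (hXc : ∀ x : X, Continuous fun s : G => X.ρ s x) (hYc : ∀ y : Y, Continuous fun s : G => Y.ρ s y)
    (hXI : ∀ (s : G) (x : X), (∀ h : G, χ h = 1 → X.ρ h x = x) → X.ρ s x = x)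
    (hYI : ∀ (s : G) (y : Y), (∀ h : G, χ h = 1 → Y.ρ h y = y) → Y.ρ s y = y)
    (ha : ∀ f : contOneCocycles X, oneCocycleClass X f = a →
      ∃ x : X, ∀ h : G, χ h = 1 → f.1 h = X.ρ h x - x)
    (hb : ∀ g : contOneCocycles Y, oneCocycleClass Y g = b →
      ∃ y : Y, ∀ h : G, χ h = 1 → g.1 h = Y.ρ h y - y)
    (hcyc : ∃ σ : G, ∀ s : G, ∃ i : ℕ, χ s = χ σ ^ i)
    (k : ℕ) (hZ : ∀ z : Z, (2 * k + 1) • z = 0) :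
    φ.cupProduct a b = 0 := by
  obtain ⟨f, rfl⟩ := oneCocycleClass_surjective X a
  obtain ⟨g, rfl⟩ := oneCocycleClass_surjective Y b
  rw [ContPairing.cupProduct_oneCocycleClass]
  exact cupClass_eq_zero_of_principal_of_cyclic φ χ f g hXc hYc hXI hYI (ha f rfl) (hb g rfl) hcyc k hZ

end Abstract

end TransverseCup

end Summit.BirchSwinnertonDyer.Rank1Residual.GaloisImage

end
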